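import Literature.NumberTheory.Sieve.ChenSiftedLower
import Literature.NumberTheory.Sieve.ChenTwinUpperBCardTools
import Literature.NumberTheory.Sieve.LinearSieveSecondRange
import HarnessLib

/-!
# Chen's Theorem I: tools for the estimate `∑_q S(A_q, 𝒫, x^{1/10})` (Chen 1973, Lemma 9, second half)

Companion of `ChenTheoremIAssembly.lean` (the assembly of Chen's Theorem I,
`P_x(1,2) ≥ 0.67 x C_x/(log x)²`, Sci. Sinica 16 (1973), from three sieve estimates at the sieving
level `z = x^{1/10}`). The second estimate (hypothesis (B) of
`Literature.NumberTheory.Sieve.Chen.Chen1973_theoremI_of`) is Chen's (32) (PDF p. 168 of the held copy;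
Nathanson's Theorem 10.5 moved from `N^{1/8}` to `N^{1/10}`): an upper bound for
`∑_{x^{1/10} ≤ q < x^{1/3}} S(A_q, 𝒫, x^{1/10})`, `A = {x − p : p ≤ x prime, p ∤ x}`, by the linear
sieve upper bound for each `A_q` at level `x^{1/2−δ}/q`, i.e. with the sieve parameter
`s_q = 10(1/2 − δ) − 10 log q/log x ∈ (1, 4]`, where the upper function `F = upperSieveFun 1` is
`2e^γ/s` on `(0, 3]` and `2e^γ(1 + J(s−1))/s` on `[3, 5]` (`LinearSieveSecondRange`). This file PROVES
the tools (no named facts, no definitions):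

* `upperSieveFun_one_antitoneOn` — `F` is nonincreasing on `(0, 4]` (on `[3, 4]`:
  `uF(u) − vF(v) = −∫_u^v f(t−1) dt ≥ −(v−u) · 2e^γ/4` because `log(t−1)/t ≤ 1/4` on `[2, 3]`, and
  `F ≥ 2e^γ/4` there), with the bounds `0 ≤ F ≤ 2e^γ` on `[1, 4]`;
* the identification of `A_q = (chenGoldbachSeq x).restrictDvd q` (`SieveFramework.restrictDvd`:
  weights `1_{q ∣ n} a(n)`, size `g(q) π(x)`, same density `g`): `sifted_restrictDvd_chenGoldbachSeq`
  (`S(A_q, P(z); x) = siftedCountDvd x q z`), `remainder_restrictDvd_chenGoldbachSeq`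
  (`r_q(d) = r(qd)` for `d ∣ P(z)`, `q ≥ z` prime), `shiftedPrimesDensity_prime_mem_Icc'` (`0 ≤ g(q) ≤ 1/(q−1)`);
* `sum_midPrimes_sum_le` — rearranging the double remainder sum,
  `∑_{z ≤ q < y} ∑_{d < D/q, d ∣ P(z)} Φ(qd) ≤ ∑_{m ≤ D} Φ(m)` (`(q, d) ↦ qd` is injective);
* `sum_midPrimes_upperSieveFun_div_le` — the prime sum of the main terms against the monotone weight
  `G(β) = F(10θ − 10β)` (`ChenTwinUpperBCardTools.sum_window_div_le_integral_of_monotoneOn`):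
  `∑_{x^{1/10} ≤ q < x^{1/3}} F(10θ − 10 log q/log x)/q ≤ ∫_{1/10}^{1/3} F(10θ − 10β) dβ/β + 2e^γ(log(10/3)/K + 400K/log x)`;
* `exists_integral_upperSieveFun_shift_le` — continuity of that integral at `θ = 1/2`:
  `∫ F(5 − 10δ − 10β) dβ/β ≤ ∫ F(5 − 10β) dβ/β + ε log(10/3)` for small `δ ≥ 0`
  (uniform continuity of `F` on `[1, 5]`).

## References

* Chen Jing-run, Sci. Sinica 16 (1973) 157–176, Lemma 9, (32) (PDF p. 168 of the held copy).
  [ChenSciSinica1973]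
* M. B. Nathanson, *Additive Number Theory: The Classical Bases*, GTM 164 (1996), Thm 10.5 and its
  proof, pp. 172–175 of the held copy. [Nathanson1996]
-/

open Finset Filter Topology

noncomputable section

namespace Literature.NumberTheory.Sieve.Chen

open SieveSequence

/-! ### The upper function `F = upperSieveFun 1` on `(0, 4]` -/

/-- `log(t − 1)/t ≤ 1/4` for `2 ≤ t ≤ 3` (`log(t−1) ≤ log 2 + (t−3)/2`, the tangent at `t = 3`, and
`log 2 < 0.694`). [folklore] -/
theorem log_sub_one_div_le_quarter {t : ℝ} (ht2 : 2 ≤ t) (ht3 : t ≤ 3) :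
    Real.log (t - 1) / t ≤ 1 / 4 := by
  have ht0 : 0 < t := by linarith
  have h1 : 0 < (t - 1) / 2 := by linarith
  have hlog : Real.log (t - 1) ≤ Real.log 2 + (t - 3) / 2 := by
    have h := Real.log_le_sub_one_of_pos h1
    rw [Real.log_div (by linarith) (by norm_num)] at h
    linarith
  have hl2 := Real.log_two_lt_d9
  rw [div_le_iff₀ ht0]
  norm_num at hl2
  linarith

/-- `J(b) − J(a) ≤ (b − a)/4` for `2 ≤ a ≤ b ≤ 3` (`J(w) = ∫_2^w log(t−1)/t dt`, `linearSieveJ`).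
[folklore] -/
theorem linearSieveJ_sub_le {a b : ℝ} (ha : 2 ≤ a) (hab : a ≤ b) (hb : b ≤ 3) :
    linearSieveJ b - linearSieveJ a ≤ (b - a) / 4 := by
  have hsub : Set.uIcc 2 b ⊆ Set.Ioi 1 := fun t ht => by
    rw [Set.mem_uIcc] at ht
    rw [Set.mem_Ioi]
    rcases ht with ⟨h1, -⟩ | ⟨h1, -⟩ <;> linarith
  have hint : IntervalIntegrable (fun t : ℝ => Real.log (t - 1) / t) MeasureTheory.volume 2 b :=
    (continuousOn_log_sub_one_div.mono hsub).intervalIntegrable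
  have h1 : IntervalIntegrable (fun t : ℝ => Real.log (t - 1) / t) MeasureTheory.volume 2 a :=
    hint.mono_set (by
      rw [Set.uIcc_of_le ha, Set.uIcc_of_le (ha.trans hab)]
      exact Set.Icc_subset_Icc le_rfl hab)
  have h2 : IntervalIntegrable (fun t : ℝ => Real.log (t - 1) / t) MeasureTheory.volume a b :=
    hint.mono_set (by
      rw [Set.uIcc_of_le hab, Set.uIcc_of_le (ha.trans hab)]
      exact Set.Icc_subset_Icc ha le_rfl)
  have hJ : linearSieveJ b - linearSieveJ a = ∫ t in a..b, Real.log (t - 1) / t := by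
    rw [linearSieveJ, linearSieveJ, ← intervalIntegral.integral_add_adjacent_intervals h1 h2]
    ring
  rw [hJ]
  have hconst : IntervalIntegrable (fun _ : ℝ => (1 / 4 : ℝ)) MeasureTheory.volume a b :=
    intervalIntegrable_const
  calc ∫ t in a..b, Real.log (t - 1) / t ≤ ∫ _ in a..b, (1 / 4 : ℝ) :=
        intervalIntegral.integral_mono_on hab h2 hconst fun t ht =>
          log_sub_one_div_le_quarter (by linarith [ht.1]) (by linarith [ht.2])
    _ = (b - a) / 4 := by rw [intervalIntegral.integral_const, smul_eq_mul]; ring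

/-- `F` is nonincreasing on `[3, 4]`: for `3 ≤ u ≤ v ≤ 4`,
`uF(v)(1 + J(v−1))/v ≤ …`, precisely `F(v) = 2e^γ(1 + J(v−1))/v ≤ 2e^γ(1 + J(u−1))/u = F(u)` because
`u(J(v−1) − J(u−1)) ≤ u(v−u)/4 ≤ v − u`. [folklore] -/
theorem upperSieveFun_one_antitoneOn_Icc :
    AntitoneOn (upperSieveFun 1) (Set.Icc (3 : ℝ) 4) := by
  intro u hu v hv huv
  set A : ℝ := 2 * Real.exp Real.eulerMascheroniConstant with hA
  have hA0 : 0 < A := by positivity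
  have hu0 : (0 : ℝ) < u := by linarith [hu.1]
  have hv0 : (0 : ℝ) < v := by linarith [hv.1]
  rw [upperSieveFun_one_eq_of_mem_Icc ⟨hv.1, by linarith [hv.2]⟩,
    upperSieveFun_one_eq_of_mem_Icc ⟨hu.1, by linarith [hu.2]⟩]
  change A * (1 + linearSieveJ (v - 1)) / v ≤ A * (1 + linearSieveJ (u - 1)) / u
  have hJ := linearSieveJ_sub_le (a := u - 1) (b := v - 1) (by linarith [hu.1]) (by linarith)
    (by linarith [hv.2])
  have hJu : 0 ≤ linearSieveJ (u - 1) := linearSieveJ_nonneg (by linarith [hu.1])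
  rw [div_le_div_iff₀ hv0 hu0]
  have h1 : u * (1 + linearSieveJ (v - 1)) ≤ v * (1 + linearSieveJ (u - 1)) := by
    have h2 : u * (linearSieveJ (v - 1) - linearSieveJ (u - 1)) ≤ v - u := by
      calc u * (linearSieveJ (v - 1) - linearSieveJ (u - 1)) ≤ u * ((v - 1 - (u - 1)) / 4) :=
            mul_le_mul_of_nonneg_left hJ hu0.le
        _ = (v - u) * (u / 4) := by ring
        _ ≤ (v - u) * 1 := mul_le_mul_of_nonneg_left (by linarith [hu.2]) (by linarith)
        _ = v - u := mul_one _
    have h3 : u * linearSieveJ (u - 1) ≤ v * linearSieveJ (u - 1) :=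
      mul_le_mul_of_nonneg_right huv hJu
    nlinarith
  calc A * (1 + linearSieveJ (v - 1)) * u = A * (u * (1 + linearSieveJ (v - 1))) := by ring
    _ ≤ A * (v * (1 + linearSieveJ (u - 1))) := mul_le_mul_of_nonneg_left h1 hA0.le
    _ = A * (1 + linearSieveJ (u - 1)) * v := by ring

/-- **`F = upperSieveFun 1` is nonincreasing on `(0, 4]`** (`2e^γ/s` on `(0, 3]`, and
`upperSieveFun_one_antitoneOn_Icc` on `[3, 4]`). [folklore] -/
theorem upperSieveFun_one_antitoneOn : AntitoneOn (upperSieveFun 1) (Set.Ioc (0 : ℝ) 4) := by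
  intro u hu v hv huv
  set A : ℝ := 2 * Real.exp Real.eulerMascheroniConstant with hA
  have hA0 : 0 < A := by positivity
  have hF3 : upperSieveFun 1 3 = A / 3 := upperSieveFun_one_eq_holds (s := 3) ⟨by norm_num, le_rfl⟩
  by_cases hv3 : v ≤ 3
  · rw [upperSieveFun_one_eq_holds (s := v) ⟨hv.1, hv3⟩,
      upperSieveFun_one_eq_holds (s := u) ⟨hu.1, huv.trans hv3⟩]
    exact div_le_div_of_nonneg_left hA0.le hu.1 huv
  · push Not at hv3
    have hv' : v ∈ Set.Icc (3 : ℝ) 4 := ⟨hv3.le, hv.2⟩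
    by_cases hu3 : u ≤ 3
    · have h1 : upperSieveFun 1 v ≤ upperSieveFun 1 3 :=
        upperSieveFun_one_antitoneOn_Icc ⟨le_rfl, by norm_num⟩ hv' hv3.le
      have h2 : upperSieveFun 1 3 ≤ upperSieveFun 1 u := by
        rw [hF3, upperSieveFun_one_eq_holds (s := u) ⟨hu.1, hu3⟩]
        exact div_le_div_of_nonneg_left hA0.le hu.1 hu3
      exact h1.trans h2
    · push Not at hu3
      exact upperSieveFun_one_antitoneOn_Icc ⟨hu3.le, huv.trans hv.2⟩ hv' huv

/-- `F(s) > 0` for `0 < s ≤ 5`. [folklore] -/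
theorem upperSieveFun_one_pos {s : ℝ} (hs : s ∈ Set.Ioc (0 : ℝ) 5) : 0 < upperSieveFun 1 s := by
  have hA0 : 0 < 2 * Real.exp Real.eulerMascheroniConstant := by positivity
  by_cases h3 : s ≤ 3
  · rw [upperSieveFun_one_eq_holds (s := s) ⟨hs.1, h3⟩]
    exact div_pos hA0 hs.1
  · push Not at h3
    exact lt_of_lt_of_le (div_pos hA0 hs.1) (two_mul_exp_div_le_upperSieveFun_one ⟨h3.le, hs.2⟩)

/-- `F(s) ≤ F(1) = 2e^γ` for `1 ≤ s ≤ 4`. [folklore] -/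
theorem upperSieveFun_one_le {s : ℝ} (hs : s ∈ Set.Icc (1 : ℝ) 4) :
    upperSieveFun 1 s ≤ 2 * Real.exp Real.eulerMascheroniConstant := by
  have h1 : upperSieveFun 1 1 = 2 * Real.exp Real.eulerMascheroniConstant := by
    rw [upperSieveFun_one_eq_holds (s := 1) ⟨by norm_num, by norm_num⟩, div_one]
  rw [← h1]
  exact upperSieveFun_one_antitoneOn ⟨by norm_num, by norm_num⟩ ⟨by linarith [hs.1], hs.2⟩ hs.1

/-! ### The sequences `A_q = (chenGoldbachSeq x).restrictDvd q` -/

/-- **`S(A_q, P(z); N) = S(A_q, 𝒫, z)`**: sifting the sub-sequence of multiples of `q` by all primes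
`< z` counts the pairs `(p, n)`, `p + n = N`, `p` prime, `p ∤ N`, `q ∣ n`, with `n` free of prime
factors `r < z`, `r ∤ N` (as in `sifted_chenGoldbachSeq`). [cite: Nathanson1996, §10.2 (the sequence A_q)] -/
theorem sifted_restrictDvd_chenGoldbachSeq (N q : ℕ) (z : ℝ) :
    ((chenGoldbachSeq N).restrictDvd q).sifted N (primesProdBelow z) = siftedCountDvd N q z := by
  classical
  rw [SieveSequence.sifted, Nat.floor_natCast]
  have h1 : ∑ n ∈ (Ioc 0 N).filter (fun n : ℕ => n.Coprime (primesProdBelow z)),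
      ((chenGoldbachSeq N).restrictDvd q).a n =
      ∑ n ∈ (Ioc 0 N).filter (fun n : ℕ => n.Coprime (primesProdBelow z) ∧ q ∣ n),
        chenGoldbachWeight N n := by
    symm
    rw [← Finset.filter_filter, Finset.sum_filter]
    refine Finset.sum_congr rfl fun n _ => ?_
    simp only [SieveSequence.restrictDvd_a]
    split_ifs <;> rfl
  rw [h1, sum_chenGoldbachWeight_filter, siftedCountDvd]
  norm_cast
  refine congrArg Finset.card (Finset.ext fun a => ?_)
  simp only [Finset.mem_filter, HasAntidiagonal.mem_antidiagonal]
  constructor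
  · rintro ⟨hsum, hp, hndvd, hcop, hq⟩
    exact ⟨hsum, hp, hndvd, hq, fun r hr _ => (coprime_primesProdBelow_iff _ _).mp hcop r hr⟩
  · rintro ⟨hsum, hp, hndvd, hq, hr⟩
    refine ⟨hsum, hp, hndvd, (coprime_primesProdBelow_iff _ _).mpr fun r hrz hrdvd => ?_, hq⟩
    have hrprime : r.Prime := Nat.prime_of_mem_primesBelow hrz
    by_cases hrN : r ∣ N
    · have hrp : r ∣ a.1 := by
        have : r ∣ a.1 + a.2 := by rw [hsum]; exact hrN
        exact (Nat.dvd_add_left hrdvd).mp this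
      have := (Nat.prime_dvd_prime_iff_eq hrprime hp).mp hrp
      exact hndvd (this ▸ hrN)
    · exact hr r hrz hrN hrdvd

/-- `V(P(z))` for `A_q` is `V(z)` (the density of `A_q` is that of `A`).
[cite: Nathanson1996, (10.8)] -/
theorem densityProduct_restrictDvd_chenGoldbachSeq (N q : ℕ) (z : ℝ) :
    ((chenGoldbachSeq N).restrictDvd q).densityProduct (primesProdBelow z) = sieveProduct N z :=
  densityProduct_chenGoldbachSeq N z

/-- The size of `A_q` is `g(q) π(N)` (definition of `restrictDvd`). [folklore] -/
theorem size_restrictDvd_chenGoldbachSeq (N q : ℕ) (t : ℝ) :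
    ((chenGoldbachSeq N).restrictDvd q).size t =
      shiftedPrimesDensity N q * (Nat.primeCounting N : ℝ) :=
  rfl

/-- For a prime `q`: `0 ≤ g(q) ≤ 1/(q − 1)` (`g = shiftedPrimesDensity N`: `g(q) = 1/φ(q) = 1/(q−1)` if
`q ∤ N`, `0` if `q ∣ N`). [cite: Nathanson1996, §10.3] -/
theorem shiftedPrimesDensity_prime_mem_Icc' {N q : ℕ} (hq : q.Prime) :
    0 ≤ shiftedPrimesDensity N q ∧ shiftedPrimesDensity N q ≤ ((q : ℝ) - 1)⁻¹ := by
  rw [shiftedPrimesDensity_apply]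
  have hq1 : (0 : ℝ) < (q : ℝ) - 1 := by
    have : (2 : ℝ) ≤ q := by exact_mod_cast hq.two_le
    linarith
  split_ifs with h
  · rw [Nat.totient_prime hq, Nat.cast_sub hq.one_le, Nat.cast_one]
    exact ⟨(inv_pos.mpr hq1).le, le_rfl⟩
  · exact ⟨le_rfl, (inv_pos.mpr hq1).le⟩

/-- A prime `q` with `⌈z⌉ ≤ q` is coprime to every divisor of `P(z)`. [folklore] -/
theorem coprime_of_ceil_le_of_dvd_primesProdBelow {q d : ℕ} {z : ℝ} (hq : q.Prime) (hqz : ⌈z⌉₊ ≤ q)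
    (hd : d ∣ primesProdBelow z) : q.Coprime d := by
  rw [Nat.Prime.coprime_iff_not_dvd hq]
  intro hqd
  have hqlt : (q : ℝ) < z := (dvd_primesProdBelow_iff hq z).mp (hqd.trans hd)
  have : q < ⌈z⌉₊ := Nat.lt_ceil.mpr hqlt
  omega

/-- **`r_q(d) = r(qd)`** (Nathanson p. 173): for a prime `q ≥ ⌈z⌉` and `d ∣ P(z)` (so `(q, d) = 1`), the
remainder of `A_q` at `d` is the remainder of `A` at `qd`: `|A_{qd}| − g(d) g(q) π(N) = |A_{qd}| − g(qd) π(N)`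
(`g` multiplicative). [cite: Nathanson1996, §10.5 (proof of Thm 10.5, p. 173)] -/
theorem remainder_restrictDvd_chenGoldbachSeq {N q d : ℕ} {z : ℝ} (hq : q.Prime) (hqz : ⌈z⌉₊ ≤ q)
    (hd : d ∣ primesProdBelow z) (t : ℝ) :
    ((chenGoldbachSeq N).restrictDvd q).remainder d t = (chenGoldbachSeq N).remainder (q * d) t := by
  have hcop : q.Coprime d := coprime_of_ceil_le_of_dvd_primesProdBelow hq hqz hd
  rw [SieveSequence.remainder, SieveSequence.remainder, restrictDvd_congrSum _ hcop,
    (chenGoldbachSeq N).density_mult.map_mul_of_coprime hcop]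
  change (chenGoldbachSeq N).congrSum (q * d) t -
      (chenGoldbachSeq N).density d * ((chenGoldbachSeq N).density q * (chenGoldbachSeq N).size t) =
    (chenGoldbachSeq N).congrSum (q * d) t -
      (chenGoldbachSeq N).density q * (chenGoldbachSeq N).density d * (chenGoldbachSeq N).size t
  ring

/-! ### Rearranging the double remainder sum -/

/-- **`∑_{z ≤ q < y} ∑_{d < D/q, d ∣ P(z)} Φ(qd) ≤ ∑_{1 ≤ m ≤ D} Φ(m)`** for `Φ ≥ 0` (Nathanson p. 173): the
map `(q, d) ↦ qd` is injective on pairs with `q ≥ z` prime and `d ∣ P(z)`, and `qd < D`.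
[cite: Nathanson1996, §10.5 (proof of Thm 10.5, p. 173)] -/
theorem sum_midPrimes_sum_le {z y D : ℝ} (Φ : ℕ → ℝ) (hΦ : ∀ m, 0 ≤ Φ m) :
    ∑ q ∈ midPrimes z y, ∑ d ∈ (Finset.range ⌈D / q⌉₊).filter (· ∣ primesProdBelow z), Φ (q * d) ≤
      ∑ m ∈ Finset.Icc 1 ⌊D⌋₊, Φ m := by
  classical
  set Q := midPrimes z y with hQ
  set T : ℕ → Finset ℕ := fun q => (Finset.range ⌈D / q⌉₊).filter (· ∣ primesProdBelow z) with hT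
  have hQmem : ∀ q ∈ Q, q.Prime ∧ ⌈z⌉₊ ≤ q := fun q hq => by
    rw [hQ, midPrimes, Finset.mem_filter, Nat.mem_primesBelow] at hq
    exact ⟨hq.1.2, Nat.ceil_le.mpr hq.2⟩
  have hTmem : ∀ q d, d ∈ T q → d ∣ primesProdBelow z ∧ (d : ℝ) < D / q := fun q d hd => by
    simp only [hT, Finset.mem_filter, Finset.mem_range, Nat.lt_ceil] at hd
    exact ⟨hd.2, hd.1⟩
  have h1 : ∑ q ∈ Q, ∑ d ∈ T q, Φ (q * d) = ∑ σ ∈ Q.sigma T, Φ (σ.1 * σ.2) :=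
    (Finset.sum_sigma Q T (fun σ => Φ (σ.1 * σ.2))).symm
  have hinj : Set.InjOn (fun σ : (Σ _ : ℕ, ℕ) => σ.1 * σ.2) ↑(Q.sigma T) := by
    rintro ⟨q, d⟩ hσ ⟨q', d'⟩ hσ' heq
    rw [Finset.mem_coe, Finset.mem_sigma] at hσ hσ'
    simp only at heq
    obtain ⟨hq, hqz⟩ := hQmem q hσ.1
    obtain ⟨hq', hqz'⟩ := hQmem q' hσ'.1
    have hd' := (hTmem q' d' hσ'.2).1
    have hqq' : q = q' := by
      have h2 : q ∣ q' * d' := heq ▸ dvd_mul_right q d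
      rcases (Nat.Prime.dvd_mul hq).mp h2 with h3 | h3
      · exact (Nat.prime_dvd_prime_iff_eq hq hq').mp h3
      · exact absurd h3 ((Nat.Prime.coprime_iff_not_dvd hq).mp
          (coprime_of_ceil_le_of_dvd_primesProdBelow hq hqz hd'))
    subst hqq'
    have hdd' : d = d' := Nat.eq_of_mul_eq_mul_left hq.pos heq
    subst hdd'
    rfl
  change ∑ q ∈ Q, ∑ d ∈ T q, Φ (q * d) ≤ ∑ m ∈ Finset.Icc 1 ⌊D⌋₊, Φ m
  rw [h1, ← Finset.sum_image hinj]
  refine Finset.sum_le_sum_of_subset_of_nonneg (fun m hm => ?_) fun m _ _ => hΦ m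
  rw [Finset.mem_image] at hm
  obtain ⟨⟨q, d⟩, hσ, rfl⟩ := hm
  rw [Finset.mem_sigma] at hσ
  obtain ⟨hq, -⟩ := hQmem q hσ.1
  obtain ⟨hd, hdlt⟩ := hTmem q d hσ.2
  have hd0 : d ≠ 0 := fun h0 => by
    rw [h0, zero_dvd_iff] at hd; exact primesProdBelow_ne_zero z hd
  have hq0 : (0 : ℝ) < q := by exact_mod_cast hq.pos
  rw [Finset.mem_Icc]
  refine ⟨Nat.one_le_iff_ne_zero.mpr (mul_ne_zero hq.ne_zero hd0), Nat.le_floor ?_⟩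
  rw [lt_div_iff₀' hq0] at hdlt
  push_cast
  exact hdlt.le

/-! ### The prime sum of the main terms -/

/-- **The prime sum against the monotone weight `F(10θ − 10β)`** (Chen's (32); Nathanson pp. 174–175
at `N^{1/8}`): for `x^{1/10} ≥ 3`, `1/2 − 1/30 ≤ θ ≤ 1/2` and `K ≥ 1`,
`∑_{x^{1/10} ≤ q < x^{1/3}} F(10θ − 10 log q/log x)/q ≤ ∫_{1/10}^{1/3} F(10θ − 10β) dβ/β + 2e^γ (log(10/3)/K + 400K/log x)`
(`F` nonincreasing on `(0, 4]`, so `β ↦ F(10θ − 10β)` is nondecreasing on `[1/10, 1/3]`, with values in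
`[0, 2e^γ]`; `ChenTwinUpperBCardTools.sum_window_div_le_integral_of_monotoneOn`).
[cite: ChenSciSinica1973, Lemma 9 (32)] -/
theorem sum_midPrimes_upperSieveFun_div_le {x θ : ℝ} (h3 : 3 ≤ x ^ (1 / 10 : ℝ)) (hx : 1 < x)
    (hθ1 : 1 / 2 - 1 / 30 ≤ θ) (hθ2 : θ ≤ 1 / 2) {K : ℕ} (hK : 0 < K) :
    ∑ q ∈ midPrimes (x ^ (1 / 10 : ℝ)) (x ^ (1 / 3 : ℝ)),
        upperSieveFun 1 (10 * θ - 10 * (Real.log q / Real.log x)) / q ≤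
      (∫ β in (1 / 10 : ℝ)..(1 / 3), upperSieveFun 1 (10 * θ - 10 * β) / β) +
        2 * Real.exp Real.eulerMascheroniConstant *
          (Real.log ((1 / 3 : ℝ) / (1 / 10)) / K + 40 * K / (1 / 10 * Real.log x)) := by
  set G : ℝ → ℝ := fun β => upperSieveFun 1 (10 * θ - 10 * β) with hG
  have hrange : ∀ β ∈ Set.Icc (1 / 10 : ℝ) (1 / 3), 10 * θ - 10 * β ∈ Set.Ioc (0 : ℝ) 4 ∧
      (1 : ℝ) ≤ 10 * θ - 10 * β := fun β hβ =>
    ⟨⟨by linarith [hβ.2], by linarith [hβ.1]⟩, by linarith [hβ.2]⟩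
  have hGmono : MonotoneOn G (Set.Icc (1 / 10 : ℝ) (1 / 3)) := by
    intro β hβ β' hβ' hle
    exact upperSieveFun_one_antitoneOn (hrange β' hβ').1 (hrange β hβ).1 (by linarith)
  have hG0 : ∀ β ∈ Set.Icc (1 / 10 : ℝ) (1 / 3), 0 ≤ G β := fun β hβ =>
    (upperSieveFun_one_pos ⟨(hrange β hβ).1.1, by linarith [(hrange β hβ).1.2]⟩).le
  have hGM : ∀ β ∈ Set.Icc (1 / 10 : ℝ) (1 / 3), G β ≤ 2 * Real.exp Real.eulerMascheroniConstant :=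
    fun β hβ => upperSieveFun_one_le ⟨(hrange β hβ).2, (hrange β hβ).1.2⟩
  have h := sum_window_div_le_integral_of_monotoneOn (x := x) (βa := 1 / 10) (βb := 1 / 3)
    (M := 2 * Real.exp Real.eulerMascheroniConstant) hx (by norm_num) (by norm_num) h3 hGmono hG0
    hGM hK
  exact h

/-- **Continuity of the main-term integral at `θ = 1/2`**: for every `ε > 0` there is `ρ > 0` such
that for `0 ≤ δ < ρ`,
`∫_{1/10}^{1/3} F(5 − 10δ − 10β) dβ/β ≤ ∫_{1/10}^{1/3} F(5 − 10β) dβ/β + ε log((1/3)/(1/10))`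
(`F` is uniformly continuous on `[1, 5]`). [folklore] -/
theorem exists_integral_upperSieveFun_shift_le {ε : ℝ} (hε : 0 < ε) :
    ∃ ρ : ℝ, 0 < ρ ∧ ∀ δ : ℝ, 0 ≤ δ → δ < ρ →
      (∫ β in (1 / 10 : ℝ)..(1 / 3), upperSieveFun 1 (5 - 10 * δ - 10 * β) / β) ≤
        (∫ β in (1 / 10 : ℝ)..(1 / 3), upperSieveFun 1 (5 - 10 * β) / β) +
          ε * Real.log ((1 / 3 : ℝ) / (1 / 10)) := by
  have hcont : ContinuousOn (upperSieveFun 1) (Set.Ioi 0) :=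
    isBetaSieveSolution_upperSieveFun_one.continuousOn_upper
  have hK : IsCompact (Set.Icc (1 : ℝ) 5) := isCompact_Icc
  have hUC := hK.uniformContinuousOn_of_continuous
    (hcont.mono fun s hs => show (0 : ℝ) < s by linarith [hs.1])
  obtain ⟨ρ₀, hρ₀, hρ₀'⟩ := Metric.uniformContinuousOn_iff_le.mp hUC ε hε
  refine ⟨min (ρ₀ / 10) (1 / 30), by positivity, fun δ hδ0 hδρ => ?_⟩
  have hδ1 : δ < ρ₀ / 10 := lt_of_lt_of_le hδρ (min_le_left _ _)
  have hδ2 : δ < 1 / 30 := lt_of_lt_of_le hδρ (min_le_right _ _)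
  -- pointwise comparison on `[1/10, 1/3]`
  have hpt : ∀ β ∈ Set.Icc (1 / 10 : ℝ) (1 / 3),
      upperSieveFun 1 (5 - 10 * δ - 10 * β) / β ≤ upperSieveFun 1 (5 - 10 * β) / β + ε / β := by
    intro β hβ
    have hβ0 : 0 < β := by linarith [hβ.1]
    have ha : 5 - 10 * δ - 10 * β ∈ Set.Icc (1 : ℝ) 5 := ⟨by linarith [hβ.2], by linarith [hβ.1]⟩
    have hb : 5 - 10 * β ∈ Set.Icc (1 : ℝ) 5 := ⟨by linarith [hβ.2], by linarith [hβ.1]⟩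
    have hdist : dist (5 - 10 * δ - 10 * β) (5 - 10 * β) ≤ ρ₀ := by
      rw [Real.dist_eq, show (5 : ℝ) - 10 * δ - 10 * β - (5 - 10 * β) = -(10 * δ) by ring, abs_neg,
        abs_of_nonneg (by positivity)]
      linarith
    have h := hρ₀' _ ha _ hb hdist
    rw [Real.dist_eq] at h
    rw [← add_div, div_le_div_iff_of_pos_right hβ0]
    linarith [(abs_le.mp h).2]
  -- integrability
  have hci : ∀ c : ℝ, 0 ≤ c → c ≤ 1 / 30 →
      ContinuousOn (fun β : ℝ => upperSieveFun 1 (5 - 10 * c - 10 * β) / β)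
        (Set.Icc (1 / 10 : ℝ) (1 / 3)) := by
    intro c hc0 hc1
    refine ContinuousOn.div ?_ continuousOn_id fun β hβ => ?_
    · refine hcont.comp (by fun_prop) fun β hβ => ?_
      show (0 : ℝ) < 5 - 10 * c - 10 * β
      linarith [hβ.2]
    · exact ne_of_gt (show (0 : ℝ) < β by linarith [hβ.1])
  have hi1 := (hci δ hδ0 hδ2.le).intervalIntegrable_of_Icc (μ := MeasureTheory.volume)
    (by norm_num : (1 / 10 : ℝ) ≤ 1 / 3)
  have hi2' := (hci 0 le_rfl (by norm_num)).intervalIntegrable_of_Icc (μ := MeasureTheory.volume)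
    (by norm_num : (1 / 10 : ℝ) ≤ 1 / 3)
  have hi2 : IntervalIntegrable (fun β : ℝ => upperSieveFun 1 (5 - 10 * β) / β)
      MeasureTheory.volume (1 / 10 : ℝ) (1 / 3) := by
    refine hi2'.congr fun β _ => ?_
    simp only [mul_zero, sub_zero]
  have hi3 : IntervalIntegrable (fun β : ℝ => ε / β) MeasureTheory.volume (1 / 10 : ℝ) (1 / 3) := by
    refine ContinuousOn.intervalIntegrable_of_Icc (by norm_num) ?_
    exact continuousOn_const.div continuousOn_id fun β hβ =>
      ne_of_gt (show (0 : ℝ) < β by linarith [hβ.1])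
  calc (∫ β in (1 / 10 : ℝ)..(1 / 3), upperSieveFun 1 (5 - 10 * δ - 10 * β) / β)
      ≤ ∫ β in (1 / 10 : ℝ)..(1 / 3), (upperSieveFun 1 (5 - 10 * β) / β + ε / β) :=
        intervalIntegral.integral_mono_on (by norm_num) hi1 (hi2.add hi3) hpt
    _ = (∫ β in (1 / 10 : ℝ)..(1 / 3), upperSieveFun 1 (5 - 10 * β) / β) +
          ∫ β in (1 / 10 : ℝ)..(1 / 3), ε / β := intervalIntegral.integral_add hi2 hi3
    _ = _ := by rw [integral_const_div_eq (by norm_num) (by norm_num)]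

end Literature.NumberTheory.Sieve.Chen
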